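import Summits.CriticalPhenomena.SAWScalingLimit.Theorems.SAWLeftRightFKGFKGToTraversalBoundNecklaceCarrier
import Literature.Probability.RandomPlanarGeometry.ExteriorULC
import Mathlib.Analysis.Normed.Module.RCLike.Real
import Mathlib.Topology.Order.IntermediateValue
import HarnessLib

/-!
# Slit necklace, chart r2 step D1: the spine blob attached at a marked lattice point

Crux `SAWLeftRightFKG.FKGToTraversalBound` (stmt-CriticalPhenomena-1878), line `slit-necklace`,
registered helper `stub_necklaceSpine`.

Let `G = (dom C δ)_δ` be an r2 presentation of the lattice domain `D_δ` minus a defect set `S`, and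
let `a₀` be a non-isolated vertex of `G` ("marked lattice point"), at depth
`d = infDist (δ a₀) Dᶜ`.  We build a finite SPINE BLOB `Ka ∋ a₀` of lattice sites, all within
`d + 3δ` of `δ a₀`, ATTACHED to the boundary walk `C`: every site of `Ka` is joined to a vertex of
`C` by a `ℤ²`-walk through `Ka ∪ C.support`.

Proof.  (1) The depth is attained at a point `p ∉ D` with `dist (δ a₀) p = d`, and `p ∈ ∂D`
(the open ball of radius `d` about `δ a₀` lies in `D`).  (2) `∂D ⊆ closure (exterior)`
(`JordanDomain.frontier_subset_closure_exterior'`), so some exterior point `e` is within `δ/2`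
of `p`.  (3) The exterior is connected and unbounded, so (intermediate value theorem for the
`ℓ^∞`-distance to the centre of the lattice cell of `e`) it meets the boundary of that cell at a
point `g` of a side `[δ t, δ t']`; hence the mesh graph has NO edge `t t'`, and both `δ t`, `δ t'`
are within `2δ` of `e` (`spine_exists_side_not_adj`).  (4) Walk from `a₀` along the monotone
lattice staircase to `t` (inside the bounding box of `a₀, t`, `spine_reflTransGen_staircase`) and
then to `t'`; the last step is not an edge of `G`, so there is a FIRST non-edge `(y, y')` along the
way; `y` is non-isolated in `G`, so by the trace dichotomy (`adj_or_mem_support`) `y'` is a vertex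
of `C`, and the sites up to `y` form the blob (`spine_blob_of_isChain`).

Only theorems; no named fact; axioms are the standard three.
-/

noncomputable section

open MeasureTheory Filter Topology Set Metric
open scoped NNReal ENNReal
open Literature.Probability.LatticeModels
open Literature.Probability.RandomPlanarGeometry
open Literature.Probability.RandomPlanarGeometry.SAW
open Summit.CriticalPhenomena.SAWScalingLimit.Theses.SAWLeftRightFKG
open Summit.CriticalPhenomena.SAWScalingLimit.Theorems.FKGToTraversalBound.Negative (dom)
open Summit.CriticalPhenomena.SAWScalingLimit.Theorems.FKGToTraversalBound.GatesByBubbleDoorsByFKG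
  (adj_or_mem_support)

namespace Summit.CriticalPhenomena.SAWScalingLimit.Theorems.FKGToTraversalBound.SlitNecklace

/-! ### Walking a lattice chain until the first non-edge of the r2 graph -/

/-- **The blob of a lattice chain.**  Walk along a `ℤ²`-chain `x :: l` starting at a non-isolated
vertex `x` of the r2 graph `(dom C δ)_δ`; if the chain is not a chain of the graph, the sites met
before the first non-edge form a finite set `Ka ∋ x` of sites of the chain, each joined to a vertex
of the boundary walk `C` by a lattice walk through `Ka` and `C.support` (at the first non-edge
`(y, y')` the vertex `y` is non-isolated, so `y' ∈ C.support` by the trace dichotomy). [folklore] -/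
theorem spine_blob_of_isChain {c : Site 2} (C : (zdGraph 2).Walk c c) {δ : ℝ} (hδ : δ ≠ 0) :
    ∀ (l : List (Site 2)) (x w : Site 2), (discreteDomainGraph (dom C δ) δ).Adj x w →
      List.IsChain (zdGraph 2).Adj (x :: l) →
      ¬ List.IsChain (discreteDomainGraph (dom C δ) δ).Adj (x :: l) →
      ∃ Ka : Finset (Site 2), x ∈ Ka ∧ (∀ k ∈ Ka, k ∈ x :: l) ∧
        ∀ k ∈ Ka, ∃ (q : Site 2) (p : (zdGraph 2).Walk k q), q ∈ C.support ∧
          ∀ z ∈ p.support, z ∈ Ka ∨ z ∈ C.support := by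
  classical
  intro l
  induction l with
  | nil => intro x w _ _ hnot; exact absurd (List.IsChain.singleton x) hnot
  | cons y l ih =>
    intro x w hxw hchain hnot
    obtain ⟨hxy, hyl⟩ := List.isChain_cons_cons.1 hchain
    by_cases hGxy : (discreteDomainGraph (dom C δ) δ).Adj x y
    · obtain ⟨Ka, hyKa, hKal, hKa⟩ :=
        ih y x hGxy.symm hyl fun h => hnot (List.IsChain.cons_cons hGxy h)
      refine ⟨insert x Ka, Finset.mem_insert_self _ _, fun k hk => ?_, fun k hk => ?_⟩
      · rcases Finset.mem_insert.1 hk with rfl | hk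
        · exact List.mem_cons_self
        · exact List.mem_cons_of_mem _ (hKal k hk)
      · have lift : ∀ z : Site 2, z ∈ Ka ∨ z ∈ C.support → z ∈ insert x Ka ∨ z ∈ C.support :=
          fun z hz => hz.imp (fun h => Finset.mem_insert_of_mem h) id
        rcases Finset.mem_insert.1 hk with rfl | hk
        · obtain ⟨q, p, hq, hp⟩ := hKa y hyKa
          refine ⟨q, SimpleGraph.Walk.cons hxy p, hq, fun z hz => ?_⟩
          rw [SimpleGraph.Walk.support_cons, List.mem_cons] at hz
          rcases hz with rfl | hz
          · exact Or.inl (Finset.mem_insert_self _ _)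
          · exact lift z (hp z hz)
        · obtain ⟨q, p, hq, hp⟩ := hKa k hk
          exact ⟨q, p, hq, fun z hz => lift z (hp z hz)⟩
    · -- the first non-edge: `y` lies on the trace
      have hyC : y ∈ C.support := (adj_or_mem_support C hδ hxw hxy).resolve_right hGxy
      refine ⟨{x}, Finset.mem_singleton_self _, fun k hk => ?_, fun k hk => ?_⟩
      · rw [Finset.mem_singleton] at hk
        rw [hk]
        exact List.mem_cons_self
      · rw [Finset.mem_singleton] at hk
        subst hk
        refine ⟨y, SimpleGraph.Walk.cons hxy SimpleGraph.Walk.nil, hyC, fun z hz => ?_⟩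
        rw [SimpleGraph.Walk.support_cons, SimpleGraph.Walk.support_nil, List.mem_cons,
          List.mem_singleton] at hz
        rcases hz with rfl | rfl
        · exact Or.inl (Finset.mem_singleton_self _)
        · exact Or.inr hyC

/-! ### The monotone lattice staircase -/

/-- A unit coordinate step is a lattice edge. [folklore] -/
theorem spine_adj_add_single (x : Site 2) (i : Fin 2) {σ : ℤ} (hσ : σ = 1 ∨ σ = -1) :
    (zdGraph 2).Adj x (x + Pi.single i σ) := by
  rw [zdGraph_adj_iff]
  rcases hσ with rfl | rfl
  · exact ⟨i, Or.inl rfl⟩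
  · exact ⟨i, Or.inr (by rw [add_assoc, ← Pi.single_add, neg_add_cancel, Pi.single_zero, add_zero])⟩

/-- An axis-parallel run of `n` unit steps `σ eᵢ` (`σ = ±1`) from `a` whose sites satisfy `P` is a
chain of the relation "lattice-adjacent with target in `P`". [folklore] -/
theorem spine_reflTransGen_line (P : Site 2 → Prop) (i : Fin 2) {σ : ℤ} (hσ : σ = 1 ∨ σ = -1)
    (a : Site 2) : ∀ n : ℕ, (∀ m : ℕ, m ≤ n → P (a + Pi.single i (σ * m))) →
      Relation.ReflTransGen (fun x y => (zdGraph 2).Adj x y ∧ P y) a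
        (a + Pi.single i (σ * n)) := by
  intro n
  induction n with
  | zero => intro _; rw [Nat.cast_zero, mul_zero, Pi.single_zero, add_zero]
  | succ n ih =>
    intro hP
    have e : a + Pi.single i (σ * ((n + 1 : ℕ) : ℤ)) = a + Pi.single i (σ * n) + Pi.single i σ := by
      rw [add_assoc, ← Pi.single_add, Nat.cast_succ, mul_add, mul_one]
    have hn := hP (n + 1) le_rfl
    rw [e] at hn ⊢
    exact (ih fun m hm => hP m (Nat.le_succ_of_le hm)).tail ⟨spine_adj_add_single _ i hσ, hn⟩

/-- **The monotone staircase.**  Any two lattice sites `a, t` are joined by a lattice chain (first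
along the first coordinate, then along the second) all of whose sites lie in the bounding box of
`{a, t}`. [folklore] -/
theorem spine_reflTransGen_staircase (a t : Site 2) :
    Relation.ReflTransGen (fun x y => (zdGraph 2).Adj x y ∧
      ∀ i, (a i ≤ y i ∧ y i ≤ t i) ∨ (t i ≤ y i ∧ y i ≤ a i)) a t := by
  have hleg : ∀ u v : ℤ, ∃ σ : ℤ, (σ = 1 ∨ σ = -1) ∧ ∃ n : ℕ, v = u + σ * n := fun u v => by
    rcases le_or_gt u v with h | h
    · exact ⟨1, Or.inl rfl, (v - u).toNat, by rw [Int.toNat_of_nonneg (sub_nonneg.2 h)]; ring⟩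
    · exact ⟨-1, Or.inr rfl, (u - v).toNat, by rw [Int.toNat_of_nonneg (by omega)]; ring⟩
  obtain ⟨σ₀, hσ₀, n₀, h₀⟩ := hleg (a 0) (t 0)
  obtain ⟨σ₁, hσ₁, n₁, h₁⟩ := hleg (a 1) (t 1)
  obtain rfl : t = a + Pi.single 0 (σ₀ * n₀) + Pi.single 1 (σ₁ * n₁) := by
    ext j; fin_cases j <;> simp [h₀, h₁]
  refine (spine_reflTransGen_line _ 0 hσ₀ a n₀ fun m hm => ?_).trans
    (spine_reflTransGen_line _ 1 hσ₁ _ n₁ fun m hm => ?_)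
  all_goals
    rcases hσ₀ with rfl | rfl <;> rcases hσ₁ with rfl | rfl <;>
      simp only [Fin.forall_fin_two, Pi.add_apply, Pi.single_eq_same,
        Pi.single_eq_of_ne (one_ne_zero : (1 : Fin 2) ≠ 0),
        Pi.single_eq_of_ne (zero_ne_one : (0 : Fin 2) ≠ 1), add_zero] <;> omega

/-- The sites of the bounding box of `{a, t}` are no farther from `δ a` than `δ t` is. [folklore] -/
theorem spine_dist_le_of_box {δ : ℝ} {a t y : Site 2}
    (hy : ∀ i, (a i ≤ y i ∧ y i ≤ t i) ∨ (t i ≤ y i ∧ y i ≤ a i)) :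
    dist (meshPoint δ y) (meshPoint δ a) ≤ dist (meshPoint δ t) (meshPoint δ a) := by
  have hsq : ∀ i, ((y i : ℝ) - a i) ^ 2 ≤ ((t i : ℝ) - a i) ^ 2 := fun i => by
    have h : (y i - a i) ^ 2 ≤ (t i - a i) ^ 2 := by
      rcases hy i with ⟨h1, h2⟩ | ⟨h1, h2⟩
      · nlinarith [mul_nonneg (sub_nonneg.2 h1) (sub_nonneg.2 h2)]
      · nlinarith [mul_nonneg (sub_nonneg.2 h1) (sub_nonneg.2 h2)]
    exact_mod_cast h
  rw [Complex.dist_eq, Complex.dist_eq, ← sq_le_sq₀ (norm_nonneg _) (norm_nonneg _),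
    Complex.sq_norm, Complex.sq_norm, Complex.normSq_apply, Complex.normSq_apply]
  simp only [Complex.sub_re, Complex.sub_im, meshPoint_re, meshPoint_im]
  nlinarith [mul_le_mul_of_nonneg_left (add_le_add (hsq 0) (hsq 1)) (sq_nonneg δ)]

/-! ### A non-edge of the mesh graph near an exterior point -/

/-- A lattice site whose mesh point is coordinatewise within `δ` of `e` is within `2δ` of `e`.
[folklore] -/
theorem spine_dist_le_two_mul {δ : ℝ} {t : Site 2} {e : ℂ}
    (h0 : |δ * t 0 - e.re| ≤ δ) (h1 : |δ * t 1 - e.im| ≤ δ) : dist (meshPoint δ t) e ≤ 2 * δ := by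
  rw [Complex.dist_eq]
  refine (Complex.norm_le_abs_re_add_abs_im _).trans ?_
  rw [Complex.sub_re, Complex.sub_im, meshPoint_re, meshPoint_im]
  linarith

/-- A point of the plane lying coordinatewise between the mesh points of a lattice edge
`[t, t + eⱼ]` lies on the rescaled closed edge. [folklore] -/
theorem spine_mem_segment {δ : ℝ} (hδ : 0 < δ) (t : Site 2) (j : Fin 2) {g : ℂ}
    (hre : δ * t 0 ≤ g.re ∧ g.re ≤ δ * (t + Pi.single j 1 : Site 2) 0)
    (him : δ * t 1 ≤ g.im ∧ g.im ≤ δ * (t + Pi.single j 1 : Site 2) 1) :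
    g ∈ segment ℝ (meshPoint δ t) (meshPoint δ (t + Pi.single j 1)) := by
  rw [segment_eq_image']
  obtain rfl | rfl : j = 0 ∨ j = 1 := by fin_cases j <;> simp
  · simp only [Pi.add_apply, Pi.single_eq_same, Pi.single_eq_of_ne (one_ne_zero : (1 : Fin 2) ≠ 0),
      add_zero, Int.cast_add, Int.cast_one] at hre him
    refine ⟨(g.re - δ * t 0) / δ, ⟨div_nonneg (by linarith) hδ.le, (div_le_one hδ).2 (by linarith)⟩,
      Complex.ext ?_ ?_⟩
    · simp only [Complex.add_re, Complex.smul_re, Complex.sub_re, meshPoint_re, smul_eq_mul,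
        Pi.add_apply, Pi.single_eq_same, Int.cast_add, Int.cast_one]
      field_simp
      ring
    · simp only [Complex.add_im, Complex.smul_im, Complex.sub_im, meshPoint_im, smul_eq_mul,
        Pi.add_apply, Pi.single_eq_of_ne (one_ne_zero : (1 : Fin 2) ≠ 0), add_zero, sub_self,
        mul_zero]
      linarith [him.1, him.2]
  · simp only [Pi.add_apply, Pi.single_eq_same, Pi.single_eq_of_ne (zero_ne_one : (0 : Fin 2) ≠ 1),
      add_zero, Int.cast_add, Int.cast_one] at hre him
    refine ⟨(g.im - δ * t 1) / δ, ⟨div_nonneg (by linarith) hδ.le, (div_le_one hδ).2 (by linarith)⟩,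
      Complex.ext ?_ ?_⟩
    · simp only [Complex.add_re, Complex.smul_re, Complex.sub_re, meshPoint_re, smul_eq_mul,
        Pi.add_apply, Pi.single_eq_of_ne (zero_ne_one : (0 : Fin 2) ≠ 1), add_zero, sub_self,
        mul_zero]
      linarith [hre.1, hre.2]
    · simp only [Complex.add_im, Complex.smul_im, Complex.sub_im, meshPoint_im, smul_eq_mul,
        Pi.add_apply, Pi.single_eq_same, Int.cast_add, Int.cast_one]
      field_simp
      ring

/-- **A dropped mesh edge near an exterior point.**  For an exterior point `e` of a Jordan domain
`D` (a point off `closure D`) and a mesh `δ > 0`, some lattice edge `[t, t + eⱼ]` with both mesh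
points within `2δ` of `e` is NOT an edge of the mesh graph of `D`: the exterior is connected
(`JordanDomain.isConnected_exterior`) and unbounded, so by the intermediate value theorem for the
`ℓ^∞`-distance to the centre of the lattice cell of `e` it meets the boundary of that cell, at a
point of a side `[δ t, δ t']` which is then not contained in `closure D`. [folklore] -/
theorem spine_exists_side_not_adj (D : DobrushinDomain) {δ : ℝ} (hδ : 0 < δ) {e : ℂ}
    (he : e ∈ (closure D.carrier)ᶜ) :
    ∃ (t : Site 2) (j : Fin 2), dist (meshPoint δ t) e ≤ 2 * δ ∧
      dist (meshPoint δ (t + Pi.single j 1)) e ≤ 2 * δ ∧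
      ¬ (meshGraph D.carrier δ).Adj t (t + Pi.single j 1) := by
  -- the lattice cell of `e`
  have hfloor : ∀ u : ℝ, ∃ i : ℤ, δ * i ≤ u ∧ u < δ * i + δ := fun u =>
    ⟨⌊u / δ⌋, by have h := Int.floor_le (u / δ); rw [le_div_iff₀ hδ] at h; linarith,
      by have h := Int.lt_floor_add_one (u / δ); rw [div_lt_iff₀ hδ] at h; linarith⟩
  obtain ⟨i₀, hi1, hi2⟩ := hfloor e.re
  obtain ⟨j₀, hj1, hj2⟩ := hfloor e.im
  -- a far exterior point
  obtain ⟨r, hr⟩ := D.isBounded.closure.subset_closedBall e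
  have hR : (0 : ℝ) ≤ |r| + 2 * δ := by positivity
  have hzE : e + ((|r| + 2 * δ : ℝ) : ℂ) ∈ (closure D.carrier)ᶜ := by
    intro hz
    have h1 := hr hz
    rw [Metric.mem_closedBall, Complex.dist_eq, add_sub_cancel_left, Complex.norm_of_nonneg hR] at h1
    linarith [le_abs_self r]
  -- crossing the boundary of the cell: intermediate value theorem on the (connected) exterior
  have hfe : max |e.re - (δ * i₀ + δ / 2)| |e.im - (δ * j₀ + δ / 2)| ≤ δ / 2 :=
    max_le (abs_le.2 ⟨by linarith, by linarith⟩) (abs_le.2 ⟨by linarith, by linarith⟩)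
  have hfz : δ / 2 ≤ max |(e + ((|r| + 2 * δ : ℝ) : ℂ)).re - (δ * i₀ + δ / 2)|
      |(e + ((|r| + 2 * δ : ℝ) : ℂ)).im - (δ * j₀ + δ / 2)| := by
    refine le_trans ?_ (le_max_left _ _)
    rw [Complex.add_re, Complex.ofReal_re]
    exact le_trans (by linarith [abs_nonneg r]) (le_abs_self _)
  have hIVT := D.toJordanDomain.isConnected_exterior.isPreconnected.intermediate_value he hzE
    (f := fun w : ℂ => max |w.re - (δ * i₀ + δ / 2)| |w.im - (δ * j₀ + δ / 2)|)
    (Continuous.continuousOn (by fun_prop)) ⟨hfe, hfz⟩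
  obtain ⟨g, hgE, hfg⟩ := hIVT
  dsimp only at hfg
  have hδ2 : (0 : ℝ) ≤ δ / 2 := by positivity
  -- the crossing point lies on a side `[δ t, δ (t + eⱼ)]` of the cell
  obtain ⟨t, j, hre, him, h0, h1, h0', h1'⟩ : ∃ (t : Site 2) (j : Fin 2),
      (δ * t 0 ≤ g.re ∧ g.re ≤ δ * (t + Pi.single j 1 : Site 2) 0) ∧
      (δ * t 1 ≤ g.im ∧ g.im ≤ δ * (t + Pi.single j 1 : Site 2) 1) ∧
      |δ * t 0 - e.re| ≤ δ ∧ |δ * t 1 - e.im| ≤ δ ∧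
      |δ * (t + Pi.single j 1 : Site 2) 0 - e.re| ≤ δ ∧ |δ * (t + Pi.single j 1 : Site 2) 1 - e.im| ≤ δ := by
    rcases le_total |g.re - (δ * i₀ + δ / 2)| |g.im - (δ * j₀ + δ / 2)| with hle | hle
    · rw [max_eq_right hle] at hfg
      rw [hfg] at hle
      obtain ⟨hA1, hA2⟩ := abs_le.1 hle
      rcases (abs_eq hδ2).1 hfg with h | h
      · -- top side
        refine ⟨![i₀, j₀ + 1], 0, ?_⟩
        simp only [Pi.add_apply, Matrix.cons_val_zero, Matrix.cons_val_one,
          Pi.single_eq_same, Pi.single_eq_of_ne (one_ne_zero : (1 : Fin 2) ≠ 0), add_zero,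
          Int.cast_add, Int.cast_one, abs_le]
        refine ⟨⟨?_, ?_⟩, ⟨?_, ?_⟩, ⟨?_, ?_⟩, ⟨?_, ?_⟩, ⟨?_, ?_⟩, ⟨?_, ?_⟩⟩ <;> linarith
      · -- bottom side
        refine ⟨![i₀, j₀], 0, ?_⟩
        simp only [Pi.add_apply, Matrix.cons_val_zero, Matrix.cons_val_one,
          Pi.single_eq_same, Pi.single_eq_of_ne (one_ne_zero : (1 : Fin 2) ≠ 0), add_zero,
          Int.cast_add, Int.cast_one, abs_le]
        refine ⟨⟨?_, ?_⟩, ⟨?_, ?_⟩, ⟨?_, ?_⟩, ⟨?_, ?_⟩, ⟨?_, ?_⟩, ⟨?_, ?_⟩⟩ <;> linarith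
    · rw [max_eq_left hle] at hfg
      rw [hfg] at hle
      obtain ⟨hB1, hB2⟩ := abs_le.1 hle
      rcases (abs_eq hδ2).1 hfg with h | h
      · -- right side
        refine ⟨![i₀ + 1, j₀], 1, ?_⟩
        simp only [Pi.add_apply, Matrix.cons_val_zero, Matrix.cons_val_one,
          Pi.single_eq_same, Pi.single_eq_of_ne (zero_ne_one : (0 : Fin 2) ≠ 1), add_zero,
          Int.cast_add, Int.cast_one, abs_le]
        refine ⟨⟨?_, ?_⟩, ⟨?_, ?_⟩, ⟨?_, ?_⟩, ⟨?_, ?_⟩, ⟨?_, ?_⟩, ⟨?_, ?_⟩⟩ <;> linarith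
      · -- left side
        refine ⟨![i₀, j₀], 1, ?_⟩
        simp only [Pi.add_apply, Matrix.cons_val_zero, Matrix.cons_val_one,
          Pi.single_eq_same, Pi.single_eq_of_ne (zero_ne_one : (0 : Fin 2) ≠ 1), add_zero,
          Int.cast_add, Int.cast_one, abs_le]
        refine ⟨⟨?_, ?_⟩, ⟨?_, ?_⟩, ⟨?_, ?_⟩, ⟨?_, ?_⟩, ⟨?_, ?_⟩, ⟨?_, ?_⟩⟩ <;> linarith
  refine ⟨t, j, spine_dist_le_two_mul h0 h1, spine_dist_le_two_mul h0' h1', fun hadj => ?_⟩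
  exact hgE ((meshGraph_adj_iff.1 hadj).2 (spine_mem_segment hδ t j hre him))

/-! ### The registered helper -/

/-- **Registered helper `stub_necklaceSpine`** (crux stmt-CriticalPhenomena-1878, line
`slit-necklace`, chart r2 step D1): **the spine blob attached at a marked lattice point.**  Let
`(dom C δ)_δ` present the lattice domain `D_δ` minus the defect set `S`, and let `a₀ ∉ S` be joined
in `D_δ` to some `w₀ ∉ S`.  Then there is a finite set `Ka ∋ a₀` of lattice sites, all within
`infDist (δ a₀) Dᶜ + 3δ` of `δ a₀`, each joined to a vertex of the boundary walk `C` by a lattice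
walk through `Ka ∪ C.support`.  Proof: the depth `d` of `δ a₀` is attained at a frontier point
`p`, near which there is an exterior point `e` (`frontier_subset_closure_exterior'`), near which
some lattice edge `[t, t']` is dropped from the mesh graph (`spine_exists_side_not_adj`); the
monotone staircase from `a₀` to `t` followed by the step to `t'` stays within `d + 3δ` of `δ a₀`
and is not a chain of the graph, so its blob (`spine_blob_of_isChain`, trace dichotomy) does it.
[folklore] -/
theorem stub_necklaceSpine : ∀ (D : DobrushinDomain) (δ : ℝ) (c : Site 2) (C : (zdGraph 2).Walk c c) (S : Finset (Site 2)) (a₀ w₀ : Site 2), 0 < δ → (∀ x y : Site 2, (discreteDomainGraph (dom C δ) δ).Adj x y ↔ ((discreteDomainGraph D.carrier δ).Adj x y ∧ x ∉ S ∧ y ∉ S)) → (discreteDomainGraph D.carrier δ).Adj a₀ w₀ → a₀ ∉ S → w₀ ∉ S → ∃ Ka : Finset (Site 2), a₀ ∈ Ka ∧ (∀ k ∈ Ka, dist (meshPoint δ k) (meshPoint δ a₀) ≤ infDist (meshPoint δ a₀) D.carrierᶜ + 3 * δ) ∧ ∀ k ∈ Ka, ∃ (q : Site 2) (w : (zdGraph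 2).Walk k q), q ∈ C.support ∧ ∀ z ∈ w.support, z ∈ Ka ∨ z ∈ C.support := by
  intro D δ c C S a₀ w₀ hδ hG ha₀w₀ ha₀S hw₀S
  have hGa₀ : (discreteDomainGraph (dom C δ) δ).Adj a₀ w₀ := (hG a₀ w₀).2 ⟨ha₀w₀, ha₀S, hw₀S⟩
  -- the marked point lies in the (open) domain
  have hx₀D : meshPoint δ a₀ ∈ D.carrier :=
    meshDomain_subset_meshVertices _ _ (discreteDomainGraph_adj_iff.1 ha₀w₀).2.1
  -- (1) the depth is attained at a frontier point `p`
  have hDc : IsClosed D.carrierᶜ := D.isOpen.isClosed_compl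
  have hDcne : D.carrierᶜ.Nonempty := Set.nonempty_compl.2 D.carrier_ne_univ
  obtain ⟨p, hpDc, hpd⟩ := hDc.exists_infDist_eq_dist hDcne (meshPoint δ a₀)
  have hdpos : 0 < infDist (meshPoint δ a₀) D.carrierᶜ :=
    (hDc.notMem_iff_infDist_pos hDcne).1 (Set.notMem_compl_iff.2 hx₀D)
  have hpfr : p ∈ frontier D.carrier := by
    rw [frontier_eq_closure_inter_closure]
    refine ⟨closure_mono (Metric.ball_infDist_compl_subset (x := meshPoint δ a₀)
      (s := D.carrier)) ?_, subset_closure hpDc⟩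
    rw [closure_ball _ hdpos.ne', Metric.mem_closedBall, dist_comm, ← hpd]
  -- (2) an exterior point `e` near `p`
  obtain ⟨e, heE, hpe⟩ := Metric.mem_closure_iff.1
    (D.toJordanDomain.frontier_subset_closure_exterior' hpfr) (δ / 2) (by positivity)
  -- (3) a dropped mesh edge `[t, t + eⱼ]` near `e`
  obtain ⟨t, j, hte, ht'e, hnadj⟩ := spine_exists_side_not_adj D hδ heE
  have hdist : ∀ s : Site 2, dist (meshPoint δ s) e ≤ 2 * δ →
      dist (meshPoint δ s) (meshPoint δ a₀) ≤ dist (meshPoint δ a₀) p + 3 * δ := by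
    intro s hs
    have h4 := dist_triangle4 (meshPoint δ s) e p (meshPoint δ a₀)
    have h5 := dist_comm p (meshPoint δ a₀)
    have h6 := dist_comm p e
    linarith
  -- (4) the staircase from `a₀` to `t`, then the step to `t + eⱼ`
  obtain ⟨l, hl, hlast⟩ :=
    List.exists_isChain_cons_of_relationReflTransGen (spine_reflTransGen_staircase a₀ t)
  have hbox : ∀ k ∈ a₀ :: l, ∀ i, (a₀ i ≤ k i ∧ k i ≤ t i) ∨ (t i ≤ k i ∧ k i ≤ a₀ i) :=
    hl.induction (fun y => ∀ i, (a₀ i ≤ y i ∧ y i ≤ t i) ∨ (t i ≤ y i ∧ y i ≤ a₀ i)) _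
      (fun _ _ hxy _ => hxy.2)
      (fun _ i => (le_total (a₀ i) (t i)).imp (fun h => ⟨le_rfl, h⟩) (fun h => ⟨h, le_rfl⟩))
  have hzd : List.IsChain (zdGraph 2).Adj (a₀ :: (l ++ [t + Pi.single j 1])) := by
    rw [← List.cons_append]
    refine (hl.imp fun _ _ h => h.1).append (List.IsChain.singleton _) fun x hx y hy => ?_
    rw [List.getLast?_eq_some_getLast (List.cons_ne_nil _ _), hlast, Option.mem_def,
      Option.some.injEq] at hx
    rw [List.head?_cons, Option.mem_def, Option.some.injEq] at hy
    subst hx hy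
    exact (zdGraph_adj_iff _ _).2 ⟨j, Or.inl rfl⟩
  have hnot : ¬ List.IsChain (discreteDomainGraph (dom C δ) δ).Adj
      (a₀ :: (l ++ [t + Pi.single j 1])) := by
    intro h
    rw [← List.cons_append] at h
    have h2 := h.rel_getLast_head_of_append (List.cons_ne_nil _ _) (List.cons_ne_nil _ _)
    rw [hlast, List.head_cons] at h2
    exact hnadj (discreteDomainGraph_adj_iff.1 ((hG _ _).1 h2).1).1
  obtain ⟨Ka, ha₀Ka, hKal, hKa⟩ :=
    spine_blob_of_isChain C hδ.ne' (l ++ [t + Pi.single j 1]) a₀ w₀ hGa₀ hzd hnot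
  refine ⟨Ka, ha₀Ka, fun k hk => ?_, hKa⟩
  rw [hpd]
  rcases List.mem_cons.1 (hKal k hk) with rfl | hk'
  · rw [dist_self]; positivity
  · rcases List.mem_append.1 hk' with hk' | hk'
    · exact (spine_dist_le_of_box (δ := δ) (hbox k (List.mem_cons_of_mem _ hk'))).trans
        (hdist t hte)
    · rw [List.mem_singleton] at hk'
      rw [hk']
      exact hdist _ ht'e

end Summit.CriticalPhenomena.SAWScalingLimit.Theorems.FKGToTraversalBound.SlitNecklace

end
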